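import Summits.NavierStokesRegularity.NavierStokesRegularity.Theorems.TypeIIInviscidRelaxationAxisymSwirlRegularZhangBarrierProfileBounds
import Summits.NavierStokesRegularity.NavierStokesRegularity.Theorems.TypeIIInviscidRelaxationAxisymSwirlRegularZhangPartialTypeIOfBarrier
import Summits.NavierStokesRegularity.NavierStokesRegularity.Theorems.TypeIIInviscidRelaxationAxisymSwirlRegularHalfLineBarrierCriterionVisc
import HarnessLib

/-!
# An explicit half-line barrier for the drift `c/√(T−t)` (Zhang 2026, κ = 1), IV: the barrier, and Zhang's theorem

Helper toward the crux `AxisymSwirlRegular` (stmt-NavierStokesRegularity-1964, route TypeIIInviscidRelaxation),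
registered line `radial_inflow_split`, criterion side `stub_oneSidedRadialCriterion` (⟨19059⟩); last of the four
files `…ZhangBarrierRiccati` / `…ZhangBarrierProfile` / `…ZhangBarrierProfileBounds` / this one.

THIS FILE:
* `ZhangBarrier.barrier c T Λ r t = Λ (T−t)^m F(r (T−t)^{−1/2})` (powers written through `exp ∘ log`), its
  `r`- and `t`-derivatives in closed form, and **the barrier inequality**
  `w_rr − w_r/r + (c/√(T−t)) w_r ≤ w_t` on `r > 0`, `t < T` (`barrier_pde`) — which is
  `Λσρ² · (F″ + (c − 1/ξ − ξ/2)F′ + mF)(rρ) ≤ 0`, i.e. `ZhangBarrier.profile_ineq`;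
* `ZhangBarrier.exists_halfLineBarrier` — for every `c, T > 0` the full clause list of the tree's time-dependent
  half-line barrier (jointly `C²` on `(0,2) × (0,T)`, continuous on `[0,2] × [0,T)`, `w(0,t)=0`, nondecreasing,
  `w ≤ C r^α` on `[0,1]` with `α = 2m > 0`, `w(1,t) ≥ 1`, `w(r,0) ≥ min(r,1)²`, the inequality), with the explicit
  `Λ = 1/κ₁ + T/(σ₀κ₂)` from the power bounds of file III;
* **`Zhang2026_partialTypeI_regularity_holds`** — the Literature named fact
  `Literature.Analysis.FluidPDE.Zhang2026_partialTypeI_regularity` (Q. S. Zhang, arXiv:2604.07785, Thm 1.1: an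
  axisymmetric classical Leray–Hopf solution on `[0,T)` from a rapidly decaying datum with `v_r ≥ −c/√(T−t)` is
  bounded on `[0,T) × ℝ³`) PROVED, by `RadialInflowComparisonT.zhang2026_partialTypeI_of_barrier` (p819821: the
  PDE half — swirl comparison, Hölder modulus at the axis, Chen–Fang–Zhang/Wei continuation, Tao persistence) applied
  to the explicit barrier.  Zhang's own §2 obtains the one-dimensional modulus abstractly (De Giorgi–Nash–Moser
  boundary regularity on a time-dependent domain); the explicit supersolution replaces that step.

Honest label: this discharges a 2026 arXiv criterion (a conditional regularity theorem), not the crux; the registered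
stubs `stub_oneSidedRadialCriterion` (envelope `C/r`, `C ≥ 2`) and `stub_aprioriRadialInflowBound` are untouched.

References: Qi S. Zhang, arXiv:2604.07785 (2026), Thm 1.1, §2, §3 [Zhang2026PartialTypeI]; H. Chen, D. Fang,
T. Zhang, DCDS 37 (2017) [ChenFangZhang2017]; D. Wei, JMAA 435 (2016) [Wei2016]; T. Tao, Anal. PDE 6 (2013) [Tao2011].
-/

noncomputable section

set_option linter.dupNamespace false

open Set Filter Topology Real

namespace Summit.NavierStokesRegularity.NavierStokesRegularity.Theorems.ZhangBarrier

/-! ## §5 The time-dependent barrier `w(r,t) = Λ (T−t)^m F(r/√(T−t))` -/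

/-- The time factor `σ(t) = (T−t)^m`, written `exp(m log(T−t))`. [new] -/
def sig (c T t : ℝ) : ℝ := exp (expo c * log (T - t))

/-- The similarity scale `ρ(t) = (T−t)^{−1/2}`, written `exp(−log(T−t)/2)`. [new] -/
def rho (T t : ℝ) : ℝ := exp (-(log (T - t) / 2))

/-- **The barrier** `w(r,t) = Λ (T−t)^m F(r (T−t)^{−1/2})`. [new] -/
def barrier (c T Λ r t : ℝ) : ℝ := Λ * sig c T t * prof c (r * rho T t)

/-- `σ > 0`. -/
theorem sig_pos (c T t : ℝ) : 0 < sig c T t := exp_pos _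

/-- `ρ > 0`. -/
theorem rho_pos (T t : ℝ) : 0 < rho T t := exp_pos _

/-- `ρ² = (T−t)⁻¹`. -/
theorem rho_sq {T t : ℝ} (hs : 0 < T - t) : rho T t ^ 2 = (T - t)⁻¹ := by
  unfold rho
  rw [sq, ← exp_add, show -(log (T - t) / 2) + -(log (T - t) / 2) = -log (T - t) by ring, exp_neg,
    exp_log hs]

/-- `√(T−t) = ρ⁻¹`. -/
theorem sqrt_eq_rho_inv {T t : ℝ} (hs : 0 < T - t) : √(T - t) = (rho T t)⁻¹ := by
  unfold rho
  rw [← exp_neg, neg_neg, sqrt_eq_rpow, rpow_def_of_pos hs]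
  congr 1; ring

/-- `σ · ρ^{2m} = 1`. -/
theorem sig_mul_rho_rpow (c T t : ℝ) : sig c T t * rho T t ^ (2 * expo c) = 1 := by
  unfold sig rho
  rw [← exp_mul, ← exp_add, show expo c * log (T - t) + -(log (T - t) / 2) * (2 * expo c) = 0 by ring,
    exp_zero]

/-- `∂_r w = Λ σ ρ F′(rρ)`. -/
theorem hasDerivAt_barrier_r {c : ℝ} (hc : c ≠ 0) (T Λ t r : ℝ) :
    HasDerivAt (fun r' => barrier c T Λ r' t) (Λ * sig c T t * rho T t * dprof c (r * rho T t)) r := by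
  have h1 : HasDerivAt (fun r' => r' * rho T t) (1 * rho T t) r := (hasDerivAt_id' r).mul_const _
  have h2 := (hasDerivAt_prof hc (r * rho T t)).comp r h1
  have h3 := h2.const_mul (Λ * sig c T t)
  exact h3.congr_deriv (by ring)

/-- `∂_r (Λσρ F′(rρ)) = Λ σ ρ² F″(rρ)`. -/
theorem hasDerivAt_dbarrier_r {c : ℝ} (hc : c ≠ 0) (T Λ t r : ℝ) :
    HasDerivAt (fun r' => Λ * sig c T t * rho T t * dprof c (r' * rho T t))
      (Λ * sig c T t * rho T t ^ 2 * ddprof c (r * rho T t)) r := by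
  have h1 : HasDerivAt (fun r' => r' * rho T t) (1 * rho T t) r := (hasDerivAt_id' r).mul_const _
  have h2 := (hasDerivAt_dprof hc (r * rho T t)).comp r h1
  have h3 := h2.const_mul (Λ * sig c T t * rho T t)
  exact h3.congr_deriv (by ring)

/-- `deriv_r w = Λσρ F′(rρ)`. -/
theorem deriv_barrier_r {c : ℝ} (hc : c ≠ 0) (T Λ t r : ℝ) :
    deriv (fun r' => barrier c T Λ r' t) r = Λ * sig c T t * rho T t * dprof c (r * rho T t) :=
  (hasDerivAt_barrier_r hc T Λ t r).deriv

/-- `iteratedDeriv 2` of `w(·,t)` is `Λσρ² F″(rρ)`. -/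
theorem iteratedDeriv_two_barrier_r {c : ℝ} (hc : c ≠ 0) (T Λ t r : ℝ) :
    iteratedDeriv 2 (fun r' => barrier c T Λ r' t) r = Λ * sig c T t * rho T t ^ 2 * ddprof c (r * rho T t) := by
  rw [show (2 : ℕ) = 1 + 1 from rfl, iteratedDeriv_succ, iteratedDeriv_one]
  have hfun : deriv (fun r' => barrier c T Λ r' t) = fun r' => Λ * sig c T t * rho T t * dprof c (r' * rho T t) :=
    funext fun r' => deriv_barrier_r hc T Λ t r'
  rw [hfun]
  exact (hasDerivAt_dbarrier_r hc T Λ t r).deriv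

/-- `∂_t w = Λ σ ρ² ((ξ/2) F′(ξ) − m F(ξ))`, `ξ = rρ`. -/
theorem hasDerivAt_barrier_t {c : ℝ} (hc : c ≠ 0) (T Λ r : ℝ) {t : ℝ} (hs : 0 < T - t) :
    HasDerivAt (fun s => barrier c T Λ r s)
      (Λ * sig c T t * rho T t ^ 2 *
        (r * rho T t / 2 * dprof c (r * rho T t) - expo c * prof c (r * rho T t))) t := by
  have hL : HasDerivAt (fun s => log (T - s)) ((0 - 1) / (T - t)) t :=
    ((hasDerivAt_const t T).sub (hasDerivAt_id' t)).log hs.ne'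
  have hσ : HasDerivAt (fun s => exp (expo c * log (T - s)))
      (exp (expo c * log (T - t)) * (expo c * ((0 - 1) / (T - t)))) t := (hL.const_mul _).exp
  have hρ : HasDerivAt (fun s => exp (-(log (T - s) / 2)))
      (exp (-(log (T - t) / 2)) * (-((0 - 1) / (T - t) / 2))) t := (hL.div_const 2).neg.exp
  have hP : HasDerivAt (fun s => prof c (r * exp (-(log (T - s) / 2))))
      (dprof c (r * exp (-(log (T - t) / 2))) * (r * (exp (-(log (T - t) / 2)) * (-((0 - 1) / (T - t) / 2))))) t :=
    (hasDerivAt_prof hc _).comp t (hρ.const_mul r)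
  have hw : HasDerivAt (fun s => Λ * exp (expo c * log (T - s)) * prof c (r * exp (-(log (T - s) / 2))))
      (Λ * (exp (expo c * log (T - t)) * (expo c * ((0 - 1) / (T - t)))) * prof c (r * exp (-(log (T - t) / 2)))
        + Λ * exp (expo c * log (T - t))
          * (dprof c (r * exp (-(log (T - t) / 2))) * (r * (exp (-(log (T - t) / 2)) * (-((0 - 1) / (T - t) / 2)))))) t :=
    (hσ.const_mul Λ).mul hP
  refine hw.congr_deriv ?_
  have h2 := rho_sq (T := T) hs
  unfold rho at h2
  unfold sig rho
  linear_combination (-(Λ * exp (expo c * log (T - t))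
    * (r * exp (-(log (T - t) / 2)) / 2 * dprof c (r * exp (-(log (T - t) / 2)))
        - expo c * prof c (r * exp (-(log (T - t) / 2)))))) * h2

/-- `deriv_t w = Λσρ²((ξ/2)F′ − mF)`. -/
theorem deriv_barrier_t {c : ℝ} (hc : c ≠ 0) (T Λ r : ℝ) {t : ℝ} (hs : 0 < T - t) :
    deriv (fun s => barrier c T Λ r s) t = Λ * sig c T t * rho T t ^ 2 *
        (r * rho T t / 2 * dprof c (r * rho T t) - expo c * prof c (r * rho T t)) :=
  (hasDerivAt_barrier_t hc T Λ r hs).deriv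

/-- **The barrier inequality** `w_rr − w_r/r + (c/√(T−t)) w_r ≤ w_t` for `r > 0`, `t < T`: after the
derivative formulas it is `Λσρ² · (F″ + (c − 1/ξ − ξ/2)F′ + mF)(ξ) ≤ 0`, `ξ = rρ` (`profile_ineq`). -/
theorem barrier_pde {c T Λ r t : ℝ} (hc : 0 < c) (hΛ : 0 < Λ) (hr : 0 < r) (ht : t < T) :
    iteratedDeriv 2 (fun ρ => barrier c T Λ ρ t) r - r⁻¹ * deriv (fun ρ => barrier c T Λ ρ t) r
      + c / √(T - t) * deriv (fun ρ => barrier c T Λ ρ t) r ≤ deriv (fun s => barrier c T Λ r s) t := by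
  have hs : 0 < T - t := by linarith
  rw [iteratedDeriv_two_barrier_r hc.ne', deriv_barrier_r hc.ne', deriv_barrier_t hc.ne' T Λ r hs,
    sqrt_eq_rho_inv hs]
  set ρ := rho T t with hρdef
  set σ := sig c T t with hσdef
  have hρ : 0 < ρ := rho_pos T t
  have hσ : 0 < σ := sig_pos c T t
  have hξ : 0 < r * ρ := mul_pos hr hρ
  have key := profile_ineq hc hξ
  have hK : 0 < Λ * σ * ρ ^ 2 := by positivity
  rw [← sub_nonneg]
  have e : Λ * σ * ρ ^ 2 * (r * ρ / 2 * dprof c (r * ρ) - expo c * prof c (r * ρ))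
      - (Λ * σ * ρ ^ 2 * ddprof c (r * ρ) - r⁻¹ * (Λ * σ * ρ * dprof c (r * ρ))
        + c / ρ⁻¹ * (Λ * σ * ρ * dprof c (r * ρ)))
      = -(Λ * σ * ρ ^ 2) * (ddprof c (r * ρ) + (c - (r * ρ)⁻¹ - r * ρ / 2) * dprof c (r * ρ)
        + expo c * prof c (r * ρ)) := by
    field_simp
    ring
  rw [e]
  exact mul_nonneg_of_nonpos_of_nonpos (by linarith) key

/-! ## §6 The clauses and the half-line barrier theorem -/

/-- Joint smoothness of `w` below `t = T`. -/
theorem contDiffOn_barrier (c T Λ : ℝ) {n : WithTop ℕ∞} :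
    ContDiffOn ℝ n (fun q : ℝ × ℝ => barrier c T Λ q.1 q.2) (univ ×ˢ Iio T) := by
  have hsub : ∀ q ∈ (univ ×ˢ Iio T : Set (ℝ × ℝ)), T - q.2 ≠ 0 := by
    intro q hq
    have : q.2 < T := (mem_prod.1 hq).2
    linarith
  have h1 : ContDiffOn ℝ n (fun q : ℝ × ℝ => T - q.2) (univ ×ˢ Iio T) := by fun_prop
  have hlog : ContDiffOn ℝ n (fun q : ℝ × ℝ => log (T - q.2)) (univ ×ˢ Iio T) := h1.log hsub
  have hsig : ContDiffOn ℝ n (fun q : ℝ × ℝ => exp (expo c * log (T - q.2))) (univ ×ˢ Iio T) :=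
    (contDiffOn_const.mul hlog).exp
  have hrho : ContDiffOn ℝ n (fun q : ℝ × ℝ => exp (-(log (T - q.2) / 2))) (univ ×ˢ Iio T) :=
    (hlog.div_const 2).neg.exp
  have harg : ContDiffOn ℝ n (fun q : ℝ × ℝ => q.1 * exp (-(log (T - q.2) / 2))) (univ ×ˢ Iio T) :=
    contDiffOn_fst.mul hrho
  have hprof : ContDiffOn ℝ n (fun q : ℝ × ℝ => prof c (q.1 * exp (-(log (T - q.2) / 2)))) (univ ×ˢ Iio T) :=
    (contDiff_prof c).comp_contDiffOn harg
  have h := (contDiffOn_const (c := Λ)).mul hsig |>.mul hprof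
  exact h

/-- **The explicit half-line barrier for the envelope `c/√(T−t)`, full clause list**: for every `c, T > 0` there
are `0 < α ≤ 1`, `C > 0` and
`w(r,t)` (here `α = 2m(c)`, `w = barrier c T Λ` with an explicit `Λ = Λ(c,T)`), jointly `C²` on `(0,2) × (0,T)`,
continuous on `[0,2] × [0,T)`, with `w(0,t) = 0`, `w(·,t)` nondecreasing on `[0,2]`, `w ≤ C r^α` on `[0,1]`,
`w(1,t) ≥ 1`, `w(r,0) ≥ min(r,1)²`, and `w_rr − w_r/r + (c/√(T−t)) w_r ≤ w_t` on `(0,2) × (0,T)`.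
(Zhang proves the existence of a modulus with these properties abstractly, §2 of the paper; this is an explicit
supersolution.) [cite: Zhang2026PartialTypeI, §2 (arXiv:2604.07785)] -/
theorem exists_halfLineBarrier_strong (c T : ℝ) (hc : 0 < c) (hT : 0 < T) :
    ∃ (α C : ℝ) (w : ℝ → ℝ → ℝ), 0 < α ∧ α ≤ 1 ∧ 0 < C ∧
      ContDiffOn ℝ 2 (fun q : ℝ × ℝ => w q.1 q.2) (Ioo 0 2 ×ˢ Ioo 0 T) ∧
      ContinuousOn (fun q : ℝ × ℝ => w q.1 q.2) (Icc 0 2 ×ˢ Ico 0 T) ∧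
      (∀ t ∈ Ico 0 T, w 0 t = 0 ∧ MonotoneOn (fun r => w r t) (Icc 0 2) ∧
        (∀ r ∈ Icc (0 : ℝ) 1, w r t ≤ C * r ^ α) ∧ 1 ≤ w 1 t) ∧
      (∀ r ∈ Icc (0 : ℝ) 2, min r 1 ^ 2 ≤ w r 0) ∧
      (∀ r ∈ Ioo (0 : ℝ) 2, ∀ t ∈ Ioo 0 T,
        iteratedDeriv 2 (fun ρ => w ρ t) r - r⁻¹ * deriv (fun ρ => w ρ t) r
            + c / Real.sqrt (T - t) * deriv (fun ρ => w ρ t) r ≤ deriv (fun s => w r s) t) := by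
  -- constants
  set m := expo c with hm_def
  have hm : 0 < m := expo_pos c
  set ρ₀ := rho T 0 with hρ₀_def
  have hρ₀ : 0 < ρ₀ := rho_pos T 0
  set σ₀ := sig c T 0 with hσ₀_def
  have hσ₀ : 0 < σ₀ := sig_pos c T 0
  set κ₁ := kappa1 c ρ₀ with hκ₁_def
  have hκ₁ : 0 < κ₁ := kappa1_pos hc hρ₀
  set κ₂ := kappa2 c (2 * ρ₀) with hκ₂_def
  have hκ₂ : 0 < κ₂ := kappa2_pos hc (by positivity)
  obtain ⟨Λ, hΛ_def⟩ : ∃ Λ : ℝ, Λ = 1 / κ₁ + T / (σ₀ * κ₂) := ⟨_, rfl⟩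
  have hΛ : 0 < Λ := by rw [hΛ_def]; positivity
  have hΛ1 : 1 / κ₁ ≤ Λ := by
    rw [hΛ_def]; exact le_add_of_nonneg_right (by positivity)
  have hΛ2 : T / (σ₀ * κ₂) ≤ Λ := by
    rw [hΛ_def]; exact le_add_of_nonneg_left (by positivity)
  refine ⟨2 * m, Λ * C0 c, barrier c T Λ, by positivity, by linarith [expo_le c],
    mul_pos hΛ (C0_pos hc), ?_, ?_, ?_, ?_, ?_⟩
  · -- joint C²
    exact (contDiffOn_barrier c T Λ).mono (prod_mono (subset_univ _) Ioo_subset_Iio_self)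
  · -- joint continuity on `[0,2] × [0,T)`
    exact ((contDiffOn_barrier c T Λ (n := 0)).continuousOn).mono (prod_mono (subset_univ _) Ico_subset_Iio_self)
  · -- slice clauses
    intro t ht
    have hs : 0 < T - t := by linarith [ht.2]
    have hρ : 0 < rho T t := rho_pos T t
    have hσ : 0 < sig c T t := sig_pos c T t
    refine ⟨?_, ?_, ?_, ?_⟩
    · simp [barrier, prof_zero]
    · intro r₁ hr₁ r₂ hr₂ h12
      simp only [barrier]
      apply mul_le_mul_of_nonneg_left _ (by positivity)
      exact monotoneOn_prof hc (show (0:ℝ) ≤ r₁ * rho T t by have := hr₁.1; positivity)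
        (show (0:ℝ) ≤ r₂ * rho T t by have := hr₂.1; positivity)
        (mul_le_mul_of_nonneg_right h12 hρ.le)
    · intro r hr
      simp only [barrier]
      have hξ0 : 0 ≤ r * rho T t := by have := hr.1; positivity
      have hb := prof_le hc hξ0
      have hsplit : (r * rho T t) ^ (2 * expo c) = r ^ (2 * expo c) * rho T t ^ (2 * expo c) :=
        mul_rpow hr.1 hρ.le
      have h1 := sig_mul_rho_rpow c T t
      calc Λ * sig c T t * prof c (r * rho T t)
          ≤ Λ * sig c T t * (C0 c * (r * rho T t) ^ (2 * expo c)) := by gcongr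
        _ = Λ * C0 c * r ^ (2 * expo c) * (sig c T t * rho T t ^ (2 * expo c)) := by rw [hsplit]; ring
        _ = Λ * C0 c * r ^ (2 * m) := by rw [h1, mul_one]
    · simp only [barrier, one_mul]
      -- `ρ₀ ≤ ρ(t)` since `T − t ≤ T`
      have hρρ : ρ₀ ≤ rho T t := by
        rw [hρ₀_def]; unfold rho
        apply exp_le_exp.2
        have : log (T - t) ≤ log (T - 0) := log_le_log hs (by linarith [ht.1])
        linarith
      have hb := prof_ge_rpow hc hρ₀ hρρ
      have h1 := sig_mul_rho_rpow c T t
      calc (1 : ℝ) ≤ Λ * κ₁ := by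
              rw [← div_le_iff₀ hκ₁]; exact hΛ1
        _ = Λ * (sig c T t * (κ₁ * rho T t ^ (2 * expo c))) := by
              rw [show sig c T t * (κ₁ * rho T t ^ (2 * expo c)) = κ₁ * (sig c T t * rho T t ^ (2 * expo c)) by ring,
                h1, mul_one]
        _ ≤ Λ * (sig c T t * prof c (rho T t)) := by gcongr
        _ = Λ * sig c T t * prof c (rho T t) := by ring
  · -- initial clause
    intro r hr
    simp only [barrier]
    have hξ0 : 0 ≤ r * ρ₀ := by have := hr.1; positivity
    have hξ2 : r * ρ₀ ≤ 2 * ρ₀ := by have := hr.2; nlinarith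
    have hb := prof_ge_sq hc (by positivity : 0 < 2 * ρ₀) hξ0 hξ2
    have hρsq : ρ₀ ^ 2 = T⁻¹ := by rw [hρ₀_def, rho_sq (by linarith : 0 < T - 0)]; simp
    have hmin : min r 1 ^ 2 ≤ r ^ 2 := by
      have h0 : 0 ≤ min r 1 := le_min hr.1 zero_le_one
      exact pow_le_pow_left₀ h0 (min_le_left r 1) 2
    have hmain : r ^ 2 ≤ Λ * σ₀ * prof c (r * ρ₀) := by
      calc r ^ 2 = (T / (σ₀ * κ₂)) * σ₀ * (κ₂ * (r ^ 2 * T⁻¹)) := by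
              field_simp
            _ ≤ Λ * σ₀ * (κ₂ * (r ^ 2 * T⁻¹)) := by gcongr
            _ = Λ * σ₀ * (κ₂ * (r * ρ₀) ^ 2) := by rw [mul_pow, hρsq]
            _ ≤ Λ * σ₀ * prof c (r * ρ₀) := by gcongr
    exact hmin.trans hmain
  · -- the PDE inequality
    intro r hr t ht
    exact barrier_pde hc hΛ hr.1 ht.2

/-- **The explicit half-line barrier for the envelope `c/√(T−t)`** — exactly the hypothesis of
`RadialInflowComparisonT.zhang2026_partialTypeI_of_barrier` (the clause list of `exists_halfLineBarrier_strong`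
without `α ≤ 1`, `0 < C`). [cite: Zhang2026PartialTypeI, §2 (arXiv:2604.07785)] -/
theorem exists_halfLineBarrier (c T : ℝ) (hc : 0 < c) (hT : 0 < T) :
    ∃ (α C : ℝ) (w : ℝ → ℝ → ℝ), 0 < α ∧
      ContDiffOn ℝ 2 (fun q : ℝ × ℝ => w q.1 q.2) (Ioo 0 2 ×ˢ Ioo 0 T) ∧
      ContinuousOn (fun q : ℝ × ℝ => w q.1 q.2) (Icc 0 2 ×ˢ Ico 0 T) ∧
      (∀ t ∈ Ico 0 T, w 0 t = 0 ∧ MonotoneOn (fun r => w r t) (Icc 0 2) ∧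
        (∀ r ∈ Icc (0 : ℝ) 1, w r t ≤ C * r ^ α) ∧ 1 ≤ w 1 t) ∧
      (∀ r ∈ Icc (0 : ℝ) 2, min r 1 ^ 2 ≤ w r 0) ∧
      (∀ r ∈ Ioo (0 : ℝ) 2, ∀ t ∈ Ioo 0 T,
        iteratedDeriv 2 (fun ρ => w ρ t) r - r⁻¹ * deriv (fun ρ => w ρ t) r
            + c / Real.sqrt (T - t) * deriv (fun ρ => w ρ t) r ≤ deriv (fun s => w r s) t) := by
  obtain ⟨α, C, w, hα, -, -, h1, h2, h3, h4, h5⟩ := exists_halfLineBarrier_strong c T hc hT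
  exact ⟨α, C, w, hα, h1, h2, h3, h4, h5⟩

end Summit.NavierStokesRegularity.NavierStokesRegularity.Theorems.ZhangBarrier

namespace Summit.NavierStokesRegularity.NavierStokesRegularity.Theorems

open Literature.Analysis.FluidPDE

/-- **Q. S. Zhang's partial Type I theorem (arXiv:2604.07785, Thm 1.1) — the Literature named fact
`Zhang2026_partialTypeI_regularity` DISCHARGED**: an axisymmetric classical Leray–Hopf solution on `[0,T)` from a
rapidly decaying datum with `v_r ≥ −c/√(T−t)` on `[0,T) × ℝ³` (`ν = 1`) is bounded on `[0,T) × ℝ³`.  Proof: the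
tree's reduction `RadialInflowComparisonT.zhang2026_partialTypeI_of_barrier` (sub-slab bounds, tube comparison of
the swirl with a time-dependent barrier, Hölder modulus of `Γ` at the axis, Chen–Fang–Zhang/Wei continuation,
Tao's persistence of regularity for the boundedness conclusion) applied to the explicit barrier
`ZhangBarrier.exists_halfLineBarrier`. [cite: Zhang2026PartialTypeI, Thm. 1.1 (arXiv:2604.07785 §1)] -/
theorem Zhang2026_partialTypeI_regularity_holds : Zhang2026_partialTypeI_regularity :=
  RadialInflowComparisonT.zhang2026_partialTypeI_of_barrier
    fun c T hc hT => ZhangBarrier.exists_halfLineBarrier c T hc hT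

/-- **The κ = 1 member of the κ-inflow family, unconditional, every viscosity** (ideator line `kappa-inflow`,
ns-idea-4, O1 at `κ = 1`; Zhang's Thm 1.1 localised to the unit tube and scaled to viscosity `ν`): an axisymmetric
classical Leray–Hopf solution on `[0,T)` at viscosity `ν > 0` from a rapidly decaying datum whose radial velocity
obeys `u_r ≥ −M √ν / √(T−t)` on the unit tube `0 < r ≤ 1`, for ANY `M > 0`, extends smoothly past `T`.  Proof:
`RadialInflowComparisonT.hasSmoothExtensionPast_of_kappaEnvelope` at `κ = 1` (p819758) with the explicit barrier
for `(c, T) = (M, νT)` (`ZhangBarrier.exists_halfLineBarrier_strong`) and the sub-slab bounds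
`RadialInflowComparisonT.exists_bound_subslab`. [cite: Zhang2026PartialTypeI, Thm. 1.1 (arXiv:2604.07785)] -/
theorem hasSmoothExtensionPast_of_sqrtEnvelope {M ν T : ℝ} {u : ℝ → EuclideanSpace ℝ (Fin 3) → EuclideanSpace ℝ (Fin 3)}
    {p : ℝ → EuclideanSpace ℝ (Fin 3) → ℝ}
    (hν : 0 < ν) (hM : 0 < M) (hT : 0 < T)
    (hcl : IsClassicalNSSolutionOn (Ico 0 T) ν 0 u p) (hLH : IsLerayHopfOn T ν 0 (u 0) u)
    (hdec : HasRapidSpatialDecay (u 0)) (hax : ∀ t ∈ Ico 0 T, IsAxisymmetric (u t))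
    (henv : ∀ t ∈ Ico 0 T, ∀ x : EuclideanSpace ℝ (Fin 3), 0 < cylRadius x → cylRadius x ≤ 1 →
      -(M * √ν / √(T - t)) ≤ radialVelocity (u t) x) :
    HasSmoothExtensionPast ν 0 u T := by
  have hbd := RadialInflowComparisonT.exists_bound_subslab hν hT hcl hLH hdec
  obtain ⟨α, C, w, hα, hα1, hC, hC2, hC0, hsl, hdat, hpde⟩ :=
    ZhangBarrier.exists_halfLineBarrier_strong M (ν * T) hM (by positivity)
  refine RadialInflowComparisonT.hasSmoothExtensionPast_of_kappaEnvelope (κ := 1) (M := M) hν hT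
    ⟨α, C, w, hα, hα1, hC, hC2, hC0, hsl, hdat, fun r hr s hs => ?_⟩ hcl hLH hdec hbd hax
    fun t ht x hx hx1 => ?_
  · have hs' : 0 < ν * T - s := by linarith [hs.2]
    have e : M * r ^ ((1 : ℝ) - 1) * (ν * T - s) ^ (-((1 : ℝ) / 2)) = M / Real.sqrt (ν * T - s) := by
      rw [sub_self, Real.rpow_zero, mul_one, Real.rpow_neg hs'.le, Real.sqrt_eq_rpow]
      ring
    rw [e]
    exact hpde r hr s hs
  · have hs' : 0 < T - t := by linarith [ht.2]
    have e : M * ν ^ (1 - (1 : ℝ) / 2) * cylRadius x ^ ((1 : ℝ) - 1) * (T - t) ^ (-((1 : ℝ) / 2))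
        = M * √ν / √(T - t) := by
      rw [sub_self, Real.rpow_zero, mul_one, Real.rpow_neg hs'.le, Real.sqrt_eq_rpow, Real.sqrt_eq_rpow,
        show (1 : ℝ) - 1 / 2 = 1 / 2 by norm_num]
      ring
    rw [e]
    exact henv t ht x hx hx1

end Summit.NavierStokesRegularity.NavierStokesRegularity.Theorems

end
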